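import Literature.IUT.HodgeArakelov.LabelClassesOfCuspsR2
import Literature.IUT.HodgeArakelov.LabelClassesOfCuspsCor24iProofs

/-!
# [IUTchII] Rmk 2.3.1: `I ∩ Π_⊆ = I^l`, and the cuspidal inertia groups of `Π_v` are permuted by `Π^cor_v` — PROVED
# from the printed inputs

S. Mochizuki, *Inter-universal Teichmüller theory II*, kurims manuscript (Dec. 2020), §2, Remark 2.3.1, p. 69
l. 27–36 ([IUTchII] Rmk 2.3.1, kurims p.69) [claim: Mochizuki2012, status: disputed] (D-0012 claim key; series
status DISPUTED — elementary group theory over the landed typings only; nothing of the series is asserted).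
PROOF-ONLY companion (abc-iut cell; DAG node `IUTchII:Rmk2.3.1`; seat abc-iut-L6-t19 gen 5) of
`LabelClassesOfCusps.lean` (abc-iut-L6-t1, p407174: the named `Prop` `Rmk231_powers` and the abstract theorem
`Rmk231_permuted`) and `LabelClassesOfCuspsR2.lean` (abc-iut-L6-t19, p408509: the Def. 2.3 (ii) statement of
record `Def23_ii'`).  No definitions; landed modules untouched.

PRINT (p. 69): "Remark 2.3.1.  In the situation of (iii), suppose that the inclusion `Π_⊆ ⊆ Π_⊇` is strict.  Then
one verifies immediately that if `I ⊆ Π_⊇` is a cuspidal inertia group of `Π_⊇`, then the cuspidal inertia group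
`I ∩ Π_⊆ ⊆ Π_⊆` of `Π_⊆` satisfies `I ∩ Π_⊆ = I^l` — where the superscript `l` is relative to the group operation on
`I`, written multiplicatively.  In particular, [even though `Π_v` (respectively, `Π̂_v`) fails to be normal in `Π^cor_v`
(respectively, `Π̂^cor_v`)] it follows — since `Π^±_v` (respectively, `Π̂^±_v`) is normal in `Π^cor_v` (respectively,
`Π̂^cor_v`) — that the cuspidal inertia groups of `Π_v` (respectively, `Π̂_v`) are permuted by the conjugation action of
`Π^cor_v` (respectively, `Π̂^cor_v`)."  The inputs the text uses, all in print nearby: Def. 2.3 (i) p. 67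
"`Π^±_v/Π_v ⥲ Δ̂^±_v/Δ̂_v ⥲ Gal(X̲̲_v/X_v) (≅ ℤ/lℤ)`" (so `Π_⊆` is NORMAL of index `l` in `Π_⊇`; the index is conjunct 3
of abc-iut-L6-t1's `Def23_i_indices`); Rmk. 2.1.1 (i) p. 65 "the degree `l` covering `X̲̲_v → X_v` is totally ramified
at the cusps" / Def. 2.3 (iii) p. 68 "the inclusion `Π_⊆ ⊆ Π_⊇` corresponds to a totally ramified covering of curves"
(so NO cuspidal inertia group of `Π_⊇` lies inside `Π_⊆`); and the shape of a cuspidal inertia group, "`I_x` … is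
isomorphic to `Ẑ(1)`" ([SemiAnbd] §6 p. 71; [AbsTopI] Lem. 4.5), of which only "`[I : I^l] = l`" is used.

STATE OF THE NODE (folded).  `plan/DAG.tsv` classes `IUTchII:Rmk2.3.1` "discharged(p407174) … data/expository
node"; in the tree the FIRST printed claim is the named, unproved `Prop` `Rmk231_powers C Π_⊆ Π_⊇`
(`I ∩ Π_⊆ = Subgroup.closure {x^l : x ∈ I}`) and the SECOND is abc-iut-L6-t1's theorem `Rmk231_permuted`, proved in
the abstract with the first claim (in `↔` form, hypothesis `hV`) ASSUMED.  THIS FILE proves, with the printed inputs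
stated INLINE as hypotheses (no new `Prop`, D-0067):

* `relIndex_dvd_relIndex_of_normal_subgroupOf`, **`inf_eq_closure_pow_of_prime_relIndex`** — the group theory:
  for `A ⊴ B` of prime index `l` and `I ⊆ B` with `I ⊄ A` and `[I : I^l] = l` (`I^l :=` the subgroup generated by
  the `l`-th powers), `I ∩ A = I^l`.  ARGUMENT: `[I : I ∩ A]` divides `[B : A] = l` and is not `1`, so equals `l`;
  `I ∩ A ⊴ I`, so `x^l = x^{[I : I ∩ A]} ∈ I ∩ A` for `x ∈ I`, i.e. `I^l ⊆ I ∩ A`; both have index `l` in `I`, hence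
  they coincide.
* **`rmk231_powers_of_inputs : … → Rmk231_powers C Π_⊆ Π_⊇`** — the FIRST claim, abc-iut-L6-t1's decl BY NAME as
  the conclusion, for any pair `Π_⊆ ⊆ Π_⊇` of the tower; `rmk231_powers_piV_of_def23_i_indices` — the instance
  `(Π_v, Π^±_v)` with the index supplied BY NAME by `Def23_i_indices` (conjunct 3).
* `finiteIndex_inf_of_inputs` — under the same inputs `[I : I ∩ Π_⊆] = l`, in particular finite (the finite-index
  clause of Def. 2.3 (ii) is automatic here).
* **`isCuspidalInertia_map_conj_of_inputs`** — the SECOND claim for a pair `Π_⊆ ⊆ Π_⊇` and a group `Π_⊇⊇ ⊇ Π_⊇`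
  whose conjugation action permutes the cuspidal inertia groups of `Π_⊇` (print: "since `Π^±_v` is normal in
  `Π^cor_v`", together with the group-theoreticity of cuspidal inertia groups, Def. 2.3 (ii) / [AbsTopI] Lem. 4.5 —
  ONE inline hypothesis `hsup`): conjugation by `Π_⊇⊇` permutes the cuspidal inertia groups of `Π_⊆`.  Uses the
  Def. 2.3 (ii) statement OF RECORD `Def23_ii'` (conjunct 2: the cuspidal inertia groups of `Π_⊆` are the
  `I' ∩ Π_⊆`) and the first claim; this is abc-iut-L6-t1's `Rmk231_permuted` with its hypothesis `hV` DERIVED.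
  Instances: `isCuspidalInertia_piV_map_conj_of_inputs` (`Π_v ⊆ Π^±_v ⊆ Π^cor_v`, conjugation by `W.cor`) and
  `isCuspidalInertia_hat_map_conj_of_inputs` (`Π̂_v ⊆ Π̂^±_v ⊆ Π̂^cor_v`, conjugation by all of `Π̂^cor_v`).

What is NOT proved here (inputs, stated inline; owners per plan/L6): normality `Π_⊆ ⊴ Π_⊇` (Def. 2.3 (i): the
quotient is `Gal(X̲̲_v/X_v)`; abc-iut-L6-t1 typed the index, not the normality); total ramification at the cusps
(Rmk. 2.1.1 (i), an [EtTh]/[IUTchI] Ex. 3.2 model property — L2/L5); `[I : I^l] = l` for cuspidal inertia groups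
(the `Ẑ(1)`-shape, [SemiAnbd] §6 p. 71 — L3 `TemperedCurve.inertia_equiv_zHat` gives `I ≃ₜ* Ẑ`; the index
computation `[Ẑ : lẐ] = l` is not in the tree); `Π_⊇⊇`-invariance of the cuspidal inertia groups of `Π_⊇`.  Nothing here
takes a side on [IUTchIII] Cor. 3.12; typed ≠ discharged.
-/

namespace Literature.IUT.HodgeArakelov

universe u

/-! ### Plain group theory: a normal subgroup of prime index cuts a `Ẑ`-like subgroup in its `l`-th powers -/

section GroupTheory

variable {G : Type u} [Group G]

/-- For `A ⊆ B` with `A` normal in `B` and `I ⊆ B`: `[I : I ∩ A]` divides `[B : A]` (the image of `I` in the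
finite group `B/A` is a subgroup). [folklore] -/
private theorem relIndex_dvd_relIndex_of_normal_subgroupOf {A B I : Subgroup G} [hN : (A.subgroupOf B).Normal]
    (hI : I ≤ B) : A.relIndex I ∣ A.relIndex B := by
  rw [← Subgroup.relIndex_subgroupOf hI]
  exact Subgroup.relIndex_dvd_index_of_normal (A.subgroupOf B) (I.subgroupOf B)

/-- For `A ⊆ B` with `A` normal in `B` of PRIME index `l`, and `I ⊆ B` NOT contained in `A`: `[I : I ∩ A] = l`
(the image of `I` in `B/A ≅ ℤ/lℤ` is a nontrivial subgroup, hence everything — "totally ramified").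
([IUTchII] Rmk 2.3.1 p.69) [claim: Mochizuki2012, status: disputed] -/
theorem relIndex_eq_of_prime_relIndex_of_not_le {A B I : Subgroup G} [hN : (A.subgroupOf B).Normal]
    {l : ℕ} (hl : l.Prime) (hidx : A.relIndex B = l) (hI : I ≤ B) (hnot : ¬ I ≤ A) :
    A.relIndex I = l := by
  have hdvd : A.relIndex I ∣ l := hidx ▸ relIndex_dvd_relIndex_of_normal_subgroupOf hI
  rcases (Nat.dvd_prime hl).mp hdvd with h1 | h2
  · exact absurd (Subgroup.relIndex_eq_one.mp h1) hnot
  · exact h2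

/-- **The group theory of [IUTchII] Rmk. 2.3.1** (p. 69 "`I ∩ Π_⊆ = I^l`"): let `A ⊆ B` be subgroups with `A` NORMAL in
`B` of PRIME index `l` (`Π_⊆ ⊆ Π_⊇`, quotient `Gal(X̲̲_v/X_v) ≅ ℤ/lℤ`), and let `I ⊆ B` be a subgroup NOT contained
in `A` (total ramification at the cusp) whose `l`-th powers generate a subgroup `I^l` of index `l` in `I` (the
`Ẑ(1)`-shape of a cuspidal inertia group).  Then `I ∩ A = I^l`.  PROOF: `[I : I ∩ A] = l`
(`relIndex_eq_of_prime_relIndex_of_not_le`); `I ∩ A` is normal in `I`, so `x^l = x^{[I : I ∩ A]} ∈ I ∩ A` for every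
`x ∈ I` (`Subgroup.pow_index_mem`), i.e. `I^l ⊆ I ∩ A`; two nested subgroups of the same finite index in `I`
coincide.  PROVED. ([IUTchII] Rmk 2.3.1 p.69) [claim: Mochizuki2012, status: disputed] -/
theorem inf_eq_closure_pow_of_prime_relIndex {A B I : Subgroup G} [hN : (A.subgroupOf B).Normal]
    {l : ℕ} (hl : l.Prime) (hidx : A.relIndex B = l) (hAB : A ≤ B) (hI : I ≤ B) (hnot : ¬ I ≤ A)
    (hpow : (Subgroup.closure ((fun x : G => x ^ l) '' (I : Set G))).relIndex I = l) :
    I ⊓ A = Subgroup.closure ((fun x : G => x ^ l) '' (I : Set G)) := by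
  set C := Subgroup.closure ((fun x : G => x ^ l) '' (I : Set G)) with hC
  -- `[I : I ∩ A] = l`
  have hrel : A.relIndex I = l := relIndex_eq_of_prime_relIndex_of_not_le hl hidx hI hnot
  have hrel' : (A ⊓ I).relIndex I = l := by rw [Subgroup.inf_relIndex_right, hrel]
  -- `I ∩ A` is normal in `I`
  have hNI : ((A ⊓ I).subgroupOf I).Normal := by
    rw [Subgroup.normal_subgroupOf_iff inf_le_right]
    intro h k hh hk
    have hN' := (Subgroup.normal_subgroupOf_iff hAB).mp hN
    exact Subgroup.mem_inf.mpr
      ⟨hN' h k (Subgroup.mem_inf.mp hh).1 (hI hk), I.mul_mem (I.mul_mem hk (Subgroup.mem_inf.mp hh).2) (I.inv_mem hk)⟩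
  -- `x^l ∈ I ∩ A` for `x ∈ I`, i.e. `I^l ⊆ I ∩ A`
  have hCle : C ≤ I ⊓ A := by
    rw [hC, Subgroup.closure_le]
    rintro _ ⟨x, hx, rfl⟩
    have hmem := Subgroup.pow_index_mem ((A ⊓ I).subgroupOf I) ⟨x, hx⟩
    have hidxI : ((A ⊓ I).subgroupOf I).index = l := hrel'
    rw [hidxI, Subgroup.mem_subgroupOf, SubmonoidClass.coe_pow] at hmem
    exact Subgroup.mem_inf.mpr ⟨I.pow_mem hx l, (Subgroup.mem_inf.mp hmem).1⟩
  -- both have index `l` in `I`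
  refine le_antisymm ?_ hCle
  have hmul := Subgroup.relIndex_mul_relIndex C (I ⊓ A) I hCle inf_le_left
  have hIA : (I ⊓ A).relIndex I = l := by rw [inf_comm, hrel']
  rw [hIA, hpow, mul_eq_right₀ hl.ne_zero] at hmul
  exact Subgroup.relIndex_eq_one.mp hmul

/-- Under the same inputs the intersection has index `l` in `I`, in particular FINITE index — the finite-index clause
of [IUTchII] Def. 2.3 (ii) ("cuspidal inertia groups of `Π_⊇` that contain a finite index subgroup that lies inside
`Π_⊆`") is automatic for a totally ramified pair.  PROVED. ([IUTchII] Rmk 2.3.1 p.69) [claim: Mochizuki2012, status: disputed] -/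
theorem finiteIndex_inf_subgroupOf_of_prime_relIndex {A B I : Subgroup G} [hN : (A.subgroupOf B).Normal]
    {l : ℕ} (hl : l.Prime) (hidx : A.relIndex B = l) (hI : I ≤ B) (hnot : ¬ I ≤ A) :
    ((I ⊓ A).subgroupOf I).index = l ∧ ((I ⊓ A).subgroupOf I).FiniteIndex := by
  have hrel : A.relIndex I = l := relIndex_eq_of_prime_relIndex_of_not_le hl hidx hI hnot
  have h : ((I ⊓ A).subgroupOf I).index = l := by
    show (I ⊓ A).relIndex I = l
    rw [Subgroup.inf_relIndex_left, hrel]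
  exact ⟨h, ⟨by rw [h]; exact hl.ne_zero⟩⟩

/-- Conjugation commutes with "the subgroup generated by the `l`-th powers": `(I^l)^g = (I^g)^l`. [folklore] -/
private theorem map_conj_closure_pow_image (I : Subgroup G) (l : ℕ) (g : G) :
    (Subgroup.closure ((fun x : G => x ^ l) '' (I : Set G))).map (MulAut.conj g).toMonoidHom =
      Subgroup.closure ((fun x : G => x ^ l) '' (I.map (MulAut.conj g).toMonoidHom : Set G)) := by
  rw [MonoidHom.map_closure, Subgroup.coe_map, ← Set.image_comp, ← Set.image_comp]
  congr 1
  ext x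
  simp

end GroupTheory

/-! ### Remark 2.3.1 over the tower -/

section Rmk231

variable {S : BadPlaceSetting.{u}} {P : TopGroup.{u}} {T : TemperedCoverings S P} {W : PlusMinusTower T}

/-- **IUTchII:Rmk2.3.1, first claim** (kurims p. 69 l. 27–32 "if `I ⊆ Π_⊇` is a cuspidal inertia group of `Π_⊇`, then
the cuspidal inertia group `I ∩ Π_⊆ ⊆ Π_⊆` of `Π_⊆` satisfies `I ∩ Π_⊆ = I^l`") — abc-iut-L6-t1's named `Prop`
`Rmk231_powers C Π_⊆ Π_⊇` PROVED from the printed inputs, stated inline: `Π_⊆ ⊆ Π_⊇` NORMAL of index `l` (Def. 2.3 (i)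
p. 67: the quotient is `Gal(X̲̲_v/X_v) ≅ ℤ/lℤ`), every cuspidal inertia group `I` of `Π_⊇` satisfies `[I : I^l] = l`
(`I ≅ Ẑ(1)`, [SemiAnbd] §6 p. 71 / [AbsTopI] Lem. 4.5) and `I ⊄ Π_⊆` (the covering is totally ramified at the cusps,
Rmk. 2.1.1 (i) p. 65 / Def. 2.3 (iii) p. 68).  PROVED. ([IUTchII] Rmk 2.3.1 p.69) [claim: Mochizuki2012, status: disputed] -/
theorem rmk231_powers_of_inputs (C : CuspidalInertiaData W) {Qsub Qsup : Subgroup W.Corhat}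
    (hle : Qsub ≤ Qsup) (hN : (Qsub.subgroupOf Qsup).Normal) (hidx : Qsub.relIndex Qsup = S.l)
    (hZ : ∀ I, C.IsCuspidalInertia Qsup I →
      (Subgroup.closure ((fun x : W.Corhat => x ^ S.l) '' (I : Set W.Corhat))).relIndex I = S.l)
    (hram : ∀ I, C.IsCuspidalInertia Qsup I → ¬ I ≤ Qsub) :
    Literature.IUT.HodgeArakelov.Rmk231_powers C Qsub Qsup := by
  intro _ I hI
  haveI := hN
  exact inf_eq_closure_pow_of_prime_relIndex S.l_prime hidx hle (C.le_of_isCuspidalInertia hI) (hram I hI)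
    (hZ I hI)

/-- **IUTchII:Rmk2.3.1, first claim, for the pair `(Π_v, Π^±_v)`** with the index `[Π^±_v : Π_v] = l` supplied BY NAME
by abc-iut-L6-t1's typed Def. 2.3 (i) predicate `Def23_i_indices Dec W` (conjunct 3); normality, the `Ẑ(1)`-shape and
total ramification inline.  PROVED (modulo the named inputs). ([IUTchII] Rmk 2.3.1 p.69) [claim: Mochizuki2012, status: disputed] -/
theorem rmk231_powers_piV_of_def23_i_indices (C : CuspidalInertiaData W) {D : EtaleThetaData S.toThetaSetting P}
    (Dec : SubgraphDecomposition S T D) (hDef : Def23_i_indices Dec W) (hN : (W.piV.subgroupOf W.piPM).Normal)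
    (hZ : ∀ I, C.IsCuspidalInertia W.piPM I →
      (Subgroup.closure ((fun x : W.Corhat => x ^ S.l) '' (I : Set W.Corhat))).relIndex I = S.l)
    (hram : ∀ I, C.IsCuspidalInertia W.piPM I → ¬ I ≤ W.piV) :
    Literature.IUT.HodgeArakelov.Rmk231_powers C W.piV W.piPM :=
  rmk231_powers_of_inputs C W.piV_le_piPM hN (hDef Dec.Pbullet (Set.mem_insert _ _)).2.2 hZ hram

/-- Under the inputs of the first claim, `[I' : I' ∩ Π_⊆] = l` for every cuspidal inertia group `I'` of `Π_⊇`; in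
particular the finite-index clause of Def. 2.3 (ii) holds.  PROVED. ([IUTchII] Rmk 2.3.1 p.69) [claim: Mochizuki2012, status: disputed] -/
theorem finiteIndex_inf_of_inputs (C : CuspidalInertiaData W) {Qsub Qsup : Subgroup W.Corhat}
    (hN : (Qsub.subgroupOf Qsup).Normal) (hidx : Qsub.relIndex Qsup = S.l)
    (hram : ∀ I, C.IsCuspidalInertia Qsup I → ¬ I ≤ Qsub) {I' : Subgroup W.Corhat}
    (hI' : C.IsCuspidalInertia Qsup I') :
    ((I' ⊓ Qsub).subgroupOf I').index = S.l ∧ ((I' ⊓ Qsub).subgroupOf I').FiniteIndex := by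
  haveI := hN
  exact finiteIndex_inf_subgroupOf_of_prime_relIndex S.l_prime hidx (C.le_of_isCuspidalInertia hI') (hram I' hI')

/-- **IUTchII:Rmk2.3.1, second claim** (kurims p. 69 l. 32–36 "it follows — since `Π^±_v` … is normal in `Π^cor_v` … —
that the cuspidal inertia groups of `Π_v` … are permuted by the conjugation action of `Π^cor_v`"), for a pair
`Π_⊆ ⊆ Π_⊇` of the tower and a subgroup `Π_⊇⊇` whose conjugation action permutes the cuspidal inertia groups of `Π_⊇`
(HYPOTHESIS `hsup`: print's "`Π^±_v` is normal in `Π^cor_v`" together with the group-theoreticity of cuspidal inertia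
groups, Def. 2.3 (ii) / [AbsTopI] Lem. 4.5): conjugation by `Π_⊇⊇` permutes the cuspidal inertia groups of `Π_⊆`.
Uses the Def. 2.3 (ii) statement OF RECORD `Def23_ii'` (abc-iut-L6-t19, conjunct 2: the cuspidal inertia groups of
`Π_⊆` are exactly the `I' ∩ Π_⊆` for `I'` cuspidal in `Π_⊇` meeting `Π_⊆` with finite index) and the FIRST claim
(`I' ∩ Π_⊆ = I'^l`, so `(I' ∩ Π_⊆)^g = (I'^g)^l = I'^g ∩ Π_⊆`) — i.e. abc-iut-L6-t1's abstract `Rmk231_permuted` with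
its hypothesis `hV` DERIVED from `Def23_ii'` + `Rmk231_powers`.  PROVED (modulo the named inputs).
([IUTchII] Rmk 2.3.1 p.69) [claim: Mochizuki2012, status: disputed] -/
theorem isCuspidalInertia_map_conj_of_inputs (C : CuspidalInertiaData W) {Qsub Qsup Qss : Subgroup W.Corhat}
    (hDef : Literature.IUT.HodgeArakelov.Def23_ii' C Qsub Qsup)
    (hN : (Qsub.subgroupOf Qsup).Normal) (hidx : Qsub.relIndex Qsup = S.l)
    (hZ : ∀ I, C.IsCuspidalInertia Qsup I →
      (Subgroup.closure ((fun x : W.Corhat => x ^ S.l) '' (I : Set W.Corhat))).relIndex I = S.l)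
    (hram : ∀ I, C.IsCuspidalInertia Qsup I → ¬ I ≤ Qsub)
    (hsup : ∀ g ∈ Qss, ∀ I', C.IsCuspidalInertia Qsup I' →
      C.IsCuspidalInertia Qsup (I'.map (MulAut.conj g).toMonoidHom))
    {g : W.Corhat} (hg : g ∈ Qss) {J : Subgroup W.Corhat} (hJ : C.IsCuspidalInertia Qsub J) :
    C.IsCuspidalInertia Qsub (J.map (MulAut.conj g).toMonoidHom) := by
  have hle : Qsub ≤ Qsup := hDef.1
  have hlt : Qsub < Qsup := by
    refine lt_of_le_of_ne hle fun heq => ?_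
    have h1 : Qsub.relIndex Qsup = 1 := by rw [heq, Subgroup.relIndex_self]
    rw [hidx] at h1
    exact S.l_prime.one_lt.ne' h1
  have hpow : Literature.IUT.HodgeArakelov.Rmk231_powers C Qsub Qsup :=
    rmk231_powers_of_inputs C hle hN hidx hZ hram
  -- `J = I' ∩ Π_⊆ = I'^l` with `I'` cuspidal in `Π_⊇`
  obtain ⟨I', hI', -, rfl⟩ := (hDef.2.1 J).mp hJ
  have hgI' : C.IsCuspidalInertia Qsup (I'.map (MulAut.conj g).toMonoidHom) := hsup g hg I' hI'
  refine (hDef.2.1 _).mpr ⟨I'.map (MulAut.conj g).toMonoidHom, hgI',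
    (finiteIndex_inf_of_inputs C hN hidx hram hgI').2, ?_⟩
  -- `(I' ∩ Π_⊆)^g = (I'^l)^g = (I'^g)^l = I'^g ∩ Π_⊆`
  rw [hpow hlt I' hI', hpow hlt _ hgI', map_conj_closure_pow_image]

/-- **IUTchII:Rmk2.3.1, second claim, for `Π_v ⊆ Π^±_v ⊆ Π^cor_v`** (kurims p. 69): with the Def. 2.3 (ii) statement of
record `Def23_ii' C Π_v Π^±_v`, the index `[Π^±_v : Π_v] = l` BY NAME from `Def23_i_indices Dec W`, and inline: `Π_v`
normal in `Π^±_v`, the `Ẑ(1)`-shape and total ramification of the cuspidal inertia groups of `Π^±_v`, and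
"`Π^cor_v`-conjugation permutes the cuspidal inertia groups of `Π^±_v`" ("since `Π^±_v` is normal in `Π^cor_v`") —
conjugation by any element of `Π^cor_v` (`W.cor`) carries cuspidal inertia groups of `Π_v` to cuspidal inertia groups
of `Π_v`.  PROVED (modulo the named inputs). ([IUTchII] Rmk 2.3.1 p.69) [claim: Mochizuki2012, status: disputed] -/
theorem isCuspidalInertia_piV_map_conj_of_inputs (C : CuspidalInertiaData W)
    {D : EtaleThetaData S.toThetaSetting P} (Dec : SubgraphDecomposition S T D) (hDef_i : Def23_i_indices Dec W)
    (hDef : Literature.IUT.HodgeArakelov.Def23_ii' C W.piV W.piPM) (hN : (W.piV.subgroupOf W.piPM).Normal)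
    (hZ : ∀ I, C.IsCuspidalInertia W.piPM I →
      (Subgroup.closure ((fun x : W.Corhat => x ^ S.l) '' (I : Set W.Corhat))).relIndex I = S.l)
    (hram : ∀ I, C.IsCuspidalInertia W.piPM I → ¬ I ≤ W.piV)
    (hcor : ∀ g ∈ W.cor, ∀ I', C.IsCuspidalInertia W.piPM I' →
      C.IsCuspidalInertia W.piPM (I'.map (MulAut.conj g).toMonoidHom))
    {g : W.Corhat} (hg : g ∈ W.cor) {J : Subgroup W.Corhat} (hJ : C.IsCuspidalInertia W.piV J) :
    C.IsCuspidalInertia W.piV (J.map (MulAut.conj g).toMonoidHom) :=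
  isCuspidalInertia_map_conj_of_inputs C hDef hN (hDef_i Dec.Pbullet (Set.mem_insert _ _)).2.2 hZ hram hcor hg hJ

/-- **IUTchII:Rmk2.3.1, second claim, for `Π̂_v ⊆ Π̂^±_v ⊆ Π̂^cor_v`** (kurims p. 69, the "respectively" case): with
`Def23_ii' C Π̂_v Π̂^±_v` and inline: `Π̂_v` normal of index `l` in `Π̂^±_v` (Def. 2.3 (i) "`Δ̂_v` … normal open subgroup
of `Δ̂^±_v` of index `l`"), the `Ẑ(1)`-shape and total ramification, and `Π̂^cor_v`-invariance of the cuspidal inertia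
groups of the NORMAL subgroup `Π̂^±_v` (abc-iut-L6-t1's instance `pmHat_normal`) — conjugation by ANY element of `Π̂^cor_v`
permutes the cuspidal inertia groups of `Π̂_v`.  PROVED (modulo the named inputs). ([IUTchII] Rmk 2.3.1 p.69) [claim: Mochizuki2012, status: disputed] -/
theorem isCuspidalInertia_hat_map_conj_of_inputs (C : CuspidalInertiaData W)
    (hDef : Literature.IUT.HodgeArakelov.Def23_ii' C W.hat W.pmHat) (hN : (W.hat.subgroupOf W.pmHat).Normal)
    (hidx : W.hat.relIndex W.pmHat = S.l)
    (hZ : ∀ I, C.IsCuspidalInertia W.pmHat I →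
      (Subgroup.closure ((fun x : W.Corhat => x ^ S.l) '' (I : Set W.Corhat))).relIndex I = S.l)
    (hram : ∀ I, C.IsCuspidalInertia W.pmHat I → ¬ I ≤ W.hat)
    (hcor : ∀ g : W.Corhat, ∀ I', C.IsCuspidalInertia W.pmHat I' →
      C.IsCuspidalInertia W.pmHat (I'.map (MulAut.conj g).toMonoidHom))
    (g : W.Corhat) {J : Subgroup W.Corhat} (hJ : C.IsCuspidalInertia W.hat J) :
    C.IsCuspidalInertia W.hat (J.map (MulAut.conj g).toMonoidHom) :=
  isCuspidalInertia_map_conj_of_inputs C (Qss := ⊤) hDef hN hidx hZ hram (fun g _ => hcor g) (Subgroup.mem_top g)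
    hJ

end Rmk231

end Literature.IUT.HodgeArakelov
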